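import Literature.GroupTheory.CombinatorialGroupTheory.RibbonGraphEdgeDeletionSplit
import HarnessLib

/-!
# Deleting an edge of a one-vertex ribbon graph: transport to the darts of `E ∖ {e}`

Topic `Literature/GroupTheory/CombinatorialGroupTheory`; continues
`RibbonGraphEdgeDeletionCycles.lean`.  The rotation `delPerm ρ e` (on all darts of `E`, fixing
the two darts of `e`) is transported to an honest rotation `delRot ρ e` of the ribbon graph with
edge set `{x : E // x ≠ e}` along the embedding of darts `dartEmb`; we record that `dartEmb`
intertwines rotations, face permutations, powers, cycles (`SameCycle`), minimal periods, letters
and cycle products (through `FreeGroup.map Subtype.val`), and that `delRot ρ e` is transitive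
when `ρ` is.  Pure transport; no mathematics beyond `RibbonGraphEdgeDeletion*.lean`.
-/

namespace Literature.GroupTheory.CombinatorialGroupTheory

namespace RibbonGraph

open Equiv Equiv.Perm Function

universe u

variable {E : Type u}

section Emb

variable (e : E)

/-! ### The darts of `E ∖ {e}` inside the darts of `E` -/

/-- The darts of the smaller edge set as darts of `E`. [cite: ZieschangVogtColdewey1980, 3.1.6] -/
def dartEmb (e : E) (d : Dart {x : E // x ≠ e}) : Dart E := (d.1.1, d.2)

/-- `dartEmb_fst`: bookkeeping lemma of this construction (see the module docstring). [cite: ZieschangVogtColdewey1980, 3.1.6] -/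
@[simp] theorem dartEmb_fst (d : Dart {x : E // x ≠ e}) : (dartEmb e d).1 = d.1.1 := rfl

/-- `dartEmb_snd`: bookkeeping lemma of this construction (see the module docstring). [cite: ZieschangVogtColdewey1980, 3.1.6] -/
@[simp] theorem dartEmb_snd (d : Dart {x : E // x ≠ e}) : (dartEmb e d).2 = d.2 := rfl

/-- `dartEmb_fst_ne`: bookkeeping lemma of this construction (see the module docstring). [cite: ZieschangVogtColdewey1980, 3.1.6] -/
theorem dartEmb_fst_ne (d : Dart {x : E // x ≠ e}) : (dartEmb e d).1 ≠ e := d.1.2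

/-- `dartEmb_injective`: bookkeeping lemma of this construction (see the module docstring). [cite: ZieschangVogtColdewey1980, 3.1.6] -/
theorem dartEmb_injective : Function.Injective (dartEmb e) := by
  rintro ⟨⟨x, hx⟩, b⟩ ⟨⟨y, hy⟩, c⟩ h
  simp only [dartEmb, Prod.mk.injEq] at h
  obtain ⟨rfl, rfl⟩ := h
  rfl

/-- `dartEmb_flip`: bookkeeping lemma of this construction (see the module docstring). [cite: ZieschangVogtColdewey1980, 3.1.6] -/
theorem dartEmb_flip (d : Dart {x : E // x ≠ e}) : dartEmb e (flip d) = flip (dartEmb e d) := rfl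

/-- `exists_dartEmb_eq`: bookkeeping lemma of this construction (see the module docstring). [cite: ZieschangVogtColdewey1980, 3.1.6] -/
theorem exists_dartEmb_eq {d : Dart E} (hd : d.1 ≠ e) : ∃ d', dartEmb e d' = d :=
  ⟨(⟨d.1, hd⟩, d.2), rfl⟩

/-- `letter_dartEmb`: bookkeeping lemma of this construction (see the module docstring). [cite: ZieschangVogtColdewey1980, 3.1.6] -/
theorem letter_dartEmb (d : Dart {x : E // x ≠ e}) :
    FreeGroup.map Subtype.val (letter d) = letter (dartEmb e d) := by
  rcases d with ⟨x, b⟩; cases b <;> simp [dartEmb]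

/-- The darts of `E` not on `e`, as a subtype, identified with the darts of `E ∖ {e}`. [cite: ZieschangVogtColdewey1980, 3.1.6] -/
def dartSubtypeEquiv (e : E) : {d : Dart E // d.1 ≠ e} ≃ Dart {x : E // x ≠ e} where
  toFun d := (⟨d.1.1, d.2⟩, d.1.2)
  invFun d := ⟨dartEmb e d, d.1.2⟩
  left_inv _ := rfl
  right_inv _ := rfl

end Emb

/-! ### The transported rotation -/

section Rot

variable [DecidableEq E] (ρ : Perm (Dart E)) (e : E)

/-- `delPerm_fst_ne_iff`: bookkeeping lemma of this construction (see the module docstring). [cite: ZieschangVogtColdewey1980, 3.1.6] -/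
theorem delPerm_fst_ne_iff (d : Dart E) : (delPerm ρ e d).1 ≠ e ↔ d.1 ≠ e := by
  refine ⟨fun h hd => h ?_, delPerm_apply_fst_ne ρ e⟩
  rcases d with ⟨x, b⟩
  simp only at hd; subst hd
  cases b <;> simp

/-- The rotation of the ribbon graph with the edge `e` deleted, on the darts of `E ∖ {e}`.
[cite: ZieschangVogtColdewey1980, 3.1.6] -/
def delRot : Perm (Dart {x : E // x ≠ e}) :=
  (dartSubtypeEquiv e).permCongr ((delPerm ρ e).subtypePerm (delPerm_fst_ne_iff ρ e))

/-- `dartEmb_delRot`: bookkeeping lemma of this construction (see the module docstring). [cite: ZieschangVogtColdewey1980, 3.1.6] -/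
theorem dartEmb_delRot (d : Dart {x : E // x ≠ e}) :
    dartEmb e (delRot ρ e d) = delPerm ρ e (dartEmb e d) := rfl

/-- `dartEmb_face_delRot`: bookkeeping lemma of this construction (see the module docstring). [cite: ZieschangVogtColdewey1980, 3.1.6] -/
theorem dartEmb_face_delRot (d : Dart {x : E // x ≠ e}) :
    dartEmb e (face (delRot ρ e) d) = delFace ρ e (dartEmb e d) := rfl

/-- `dartEmb_face_delRot_pow`: bookkeeping lemma of this construction (see the module docstring). [cite: ZieschangVogtColdewey1980, 3.1.6] -/
theorem dartEmb_face_delRot_pow (d : Dart {x : E // x ≠ e}) (n : ℕ) :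
    dartEmb e ((face (delRot ρ e) ^ n) d) = (delFace ρ e ^ n) (dartEmb e d) := by
  induction n with
  | zero => rfl
  | succ n ih => rw [pow_succ', Perm.mul_apply, dartEmb_face_delRot, ih, pow_succ', Perm.mul_apply]

/-- `dartEmb_delRot_pow`: bookkeeping lemma of this construction (see the module docstring). [cite: ZieschangVogtColdewey1980, 3.1.6] -/
theorem dartEmb_delRot_pow (d : Dart {x : E // x ≠ e}) (n : ℕ) :
    dartEmb e ((delRot ρ e ^ n) d) = (delPerm ρ e ^ n) (dartEmb e d) := by
  induction n with
  | zero => rfl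
  | succ n ih => rw [pow_succ', Perm.mul_apply, dartEmb_delRot, ih, pow_succ', Perm.mul_apply]

section Finite

variable [Finite E]

/-- Cycles of the transported face permutation are the `delFace`-cycles of the embedded darts.
[cite: ZieschangVogtColdewey1980, 3.1.6] -/
theorem sameCycle_face_delRot_iff (d d' : Dart {x : E // x ≠ e}) :
    (face (delRot ρ e)).SameCycle d d' ↔ (delFace ρ e).SameCycle (dartEmb e d) (dartEmb e d') := by
  constructor
  · intro h
    obtain ⟨n, hn⟩ := h.exists_nat_pow_eq
    rw [← hn, dartEmb_face_delRot_pow]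
    exact (sameCycle_pow_right (f := delFace ρ e) (n := n)).2 SameCycle.rfl
  · intro h
    obtain ⟨n, hn⟩ := h.exists_nat_pow_eq
    rw [← dartEmb_face_delRot_pow, (dartEmb_injective e).eq_iff] at hn
    rw [← hn]
    exact (sameCycle_pow_right (f := face (delRot ρ e)) (n := n)).2 SameCycle.rfl

/-- Likewise for the rotations. [cite: ZieschangVogtColdewey1980, 3.1.6] -/
theorem sameCycle_delRot_iff (d d' : Dart {x : E // x ≠ e}) :
    (delRot ρ e).SameCycle d d' ↔ (delPerm ρ e).SameCycle (dartEmb e d) (dartEmb e d') := by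
  constructor
  · intro h
    obtain ⟨n, hn⟩ := h.exists_nat_pow_eq
    rw [← hn, dartEmb_delRot_pow]
    exact (sameCycle_pow_right (f := delPerm ρ e) (n := n)).2 SameCycle.rfl
  · intro h
    obtain ⟨n, hn⟩ := h.exists_nat_pow_eq
    rw [← dartEmb_delRot_pow, (dartEmb_injective e).eq_iff] at hn
    rw [← hn]
    exact (sameCycle_pow_right (f := delRot ρ e) (n := n)).2 SameCycle.rfl

variable {ρ} in
/-- Deleting an edge of a one-vertex ribbon graph gives a one-vertex ribbon graph. [cite: ZieschangVogtColdewey1980, 3.1.6] -/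
theorem IsTransitive.delRot (hρ : IsTransitive ρ) (e : E) : IsTransitive (delRot ρ e) := fun d d' =>
  (sameCycle_delRot_iff ρ e d d').2 (hρ.delPerm_sameCycle e (dartEmb_fst_ne e d) (dartEmb_fst_ne e d'))

/-- Minimal periods are preserved by the transport. [cite: ZieschangVogtColdewey1980, 3.1.6] -/
theorem minimalPeriod_face_delRot (d : Dart {x : E // x ≠ e}) :
    minimalPeriod (face (delRot ρ e)) d = minimalPeriod (delFace ρ e) (dartEmb e d) := by
  apply le_antisymm
  · apply IsPeriodicPt.minimalPeriod_le (minimalPeriod_perm_pos _ _)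
    show (⇑(face (delRot ρ e)))^[minimalPeriod (delFace ρ e) (dartEmb e d)] d = d
    rw [← pow_apply_eq_iterate]
    apply dartEmb_injective e
    rw [dartEmb_face_delRot_pow]
    exact pow_minimalPeriod_perm _ _
  · apply IsPeriodicPt.minimalPeriod_le (minimalPeriod_perm_pos _ _)
    show (⇑(delFace ρ e))^[minimalPeriod (face (delRot ρ e)) d] (dartEmb e d) = dartEmb e d
    rw [← pow_apply_eq_iterate, ← dartEmb_face_delRot_pow, pow_minimalPeriod_perm]

/-- Cycle products are preserved by the transport (through the inclusion of free groups).
[cite: ZieschangVogtColdewey1980, 3.1.6] -/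
theorem map_cycleProd_face_delRot (d : Dart {x : E // x ≠ e}) :
    FreeGroup.map Subtype.val (cycleProd (face (delRot ρ e)) letter d) =
      cycleProd (delFace ρ e) letter (dartEmb e d) := by
  unfold cycleProd
  rw [minimalPeriod_face_delRot]
  exact prodFrom_map_of_semiconj (face (delRot ρ e)) (delFace ρ e) (dartEmb e)
    (dartEmb_face_delRot ρ e) letter letter (FreeGroup.map Subtype.val) (letter_dartEmb e) d _

end Finite

end Rot

end RibbonGraph

end Literature.GroupTheory.CombinatorialGroupTheory
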